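import Mathlib

/-!
# (H) THE LOGISTIC COMPARISON LEMMA (nsreg-p2 g36 ROUND-46 «THE KINEMATIC CEILING» §3 seed (R46-4), plate t48-H)

Width piece for crux `EulerZoomLiouville.PowerGaugeEulerLiouville` (stmt-NavierStokesRegularity-19832), by name under LEAD 19832
(ns-typeII-p2 g13); seat ns-sfl-p1 g7, `--supports stmt-NavierStokesRegularity-19832 --as helper`.  Text = nsreg-p2 g36's
`r46/Sketch46.lean` (sha16 7c4c548940e39666) Prop `NsregP2.R46.LogisticComparison` binder-for-binder.

One-variable calculus, the EXACT skeleton of the conditional amplitude floor: if `0 < h < 1` on `[0,T]` and `h' ≥ ε h(1−h)` there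
(`ε > 0`), then `log(h(T)/(1−h(T))) ≥ log(h(0)/(1−h(0))) + εT` — the logit gains at least `εT`.
Proof: `g := logit ∘ h − ε·id` has derivative `h'/(h(1−h)) − ε ≥ 0` on `[0,T]` (`HasDerivAt.div`, `HasDerivAt.log`), hence is
monotone there (`monotoneOn_of_hasDerivWithinAt_nonneg` on the convex set `Icc 0 T`).
Use (nsreg-p2 R46 §3): with THEOREM L (`Logistic.fderiv_inflowRatio_transport`) along a backward climb, `h = −⟪V,e⟫/⟪y,e⟫` obeys
`dh/dσ = h(1−h) − ⟪∇P,e⟫/⟪y,e⟫`; under pressure domination `⟪∇P,e⟫/⟪y,e⟫ ≤ (1−ε)h(1−h)` the first-hit amplitude floor rises.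

HONEST FRAMING: one-variable real analysis; nothing here proves the crux E (19832 OPEN), any door Target, or any Navier–Stokes
statement; MODEL lattice only. [folklore (logistic comparison)]
-/

noncomputable section

open Set Filter Topology Real

set_option linter.dupNamespace false

namespace Summit.NavierStokesRegularity.NavierStokesRegularity.Theorems.PowerGaugeEulerLiouville.Logistic

/-- The derivative of `t ↦ log(h t/(1 − h t)) − ε t` at a point where `0 < h t < 1` is `h' t/(h t (1 − h t)) − ε`.
[folklore] -/
theorem hasDerivAt_logit_sub_linear {h : ℝ → ℝ} {h't ε t : ℝ} (hder : HasDerivAt h h't t) (h0 : 0 < h t)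
    (h1 : h t < 1) :
    HasDerivAt (fun s => Real.log (h s / (1 - h s)) - ε * s) (h't / (h t * (1 - h t)) - ε) t := by
  have h1' : (1 : ℝ) - h t ≠ 0 := ne_of_gt (by linarith)
  have hf : HasDerivAt (fun s => h s / (1 - h s))
      ((h't * (1 - h t) - h t * (0 - h't)) / (1 - h t) ^ 2) t :=
    hder.div ((hasDerivAt_const t (1 : ℝ)).sub hder) h1'
  have hfx : h t / (1 - h t) ≠ 0 := div_ne_zero h0.ne' h1'
  have hl := (hf.log hfx).sub ((hasDerivAt_id' t).const_mul ε)
  refine hl.congr_deriv ?_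
  field_simp
  ring

/-- **(H) THE LOGISTIC COMPARISON LEMMA.**  See the module docstring. [folklore (logistic comparison)] -/
theorem logisticComparison_of {h h' : ℝ → ℝ} {ε T : ℝ} (hε : 0 < ε) (hT : 0 ≤ T)
    (hder : ∀ t ∈ Icc 0 T, HasDerivAt h (h' t) t) (hbd : ∀ t ∈ Icc 0 T, 0 < h t ∧ h t < 1)
    (hlog : ∀ t ∈ Icc 0 T, ε * (h t * (1 - h t)) ≤ h' t) :
    Real.log (h 0 / (1 - h 0)) + ε * T ≤ Real.log (h T / (1 - h T)) := by
  have hgder : ∀ t ∈ Icc 0 T,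
      HasDerivAt (fun s => Real.log (h s / (1 - h s)) - ε * s) (h' t / (h t * (1 - h t)) - ε) t :=
    fun t ht => hasDerivAt_logit_sub_linear (hder t ht) (hbd t ht).1 (hbd t ht).2
  have hmono : MonotoneOn (fun s => Real.log (h s / (1 - h s)) - ε * s) (Icc 0 T) := by
    apply monotoneOn_of_hasDerivWithinAt_nonneg (convex_Icc 0 T)
    · exact fun t ht => (hgder t ht).continuousAt.continuousWithinAt
    · exact fun t ht => (hgder t (interior_subset ht)).hasDerivWithinAt
    · intro t ht
      have ht' : t ∈ Icc 0 T := interior_subset ht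
      obtain ⟨h0, h1⟩ := hbd t ht'
      have hpos : 0 < h t * (1 - h t) := mul_pos h0 (by linarith)
      rw [sub_nonneg, le_div_iff₀ hpos]
      exact hlog t ht'
  have hε' := hε.le
  have h := hmono (left_mem_Icc.2 hT) (right_mem_Icc.2 hT) hT
  simp only [mul_zero, sub_zero] at h
  linarith

/-- **`NsregP2.R46.LogisticComparison`, binder-for-binder** (Sketch46 of nsreg-p2 g36, sha16 7c4c548940e39666, plate t48-H).
[folklore (logistic comparison)] -/
theorem logisticComparison :
    ∀ (h h' : ℝ → ℝ) (ε T : ℝ), 0 < ε → 0 ≤ T →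
      (∀ t ∈ Icc 0 T, HasDerivAt h (h' t) t) →
      (∀ t ∈ Icc 0 T, 0 < h t ∧ h t < 1) →
      (∀ t ∈ Icc 0 T, ε * (h t * (1 - h t)) ≤ h' t) →
      Real.log (h 0 / (1 - h 0)) + ε * T ≤ Real.log (h T / (1 - h T)) :=
  fun _ _ _ _ hε hT hder hbd hlog => logisticComparison_of hε hT hder hbd hlog

end Summit.NavierStokesRegularity.NavierStokesRegularity.Theorems.PowerGaugeEulerLiouville.Logistic

end
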